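import Summits.Ventures.Crystal3D.Theorems.StickyWulffConstantCoaxialWallLawEndRowRootDefs
import Summits.Ventures.Crystal3D.Theorems.StickyWulffConstantCoaxialWallLawJammedReduction
import HarnessLib

/-!
# The ROOT-CLASS local statistic: transport under rigid motions and radius-`3` locality
# (lane T, crux `TextureLiminfV5`, stmt-Ventures-23912, registered stub `stub_terraceCensus`; cf-p1 RULING (ccc)(2)(ii) «LINK», asked of the 19481 lineage)

HONEST FRAMING. Venture `Summits/Ventures/Crystal3D` (cell `crystal3d-full`), route `route-Ventures-StickyWulffConstant`.  Census-free,
certificate-free bookkeeping for the ROOT-CLASS row `LocalEndRowRootA` of '…EndRowRootDefs' (19480-p2 g16, cf-p1 (ccc)(2)(i)): the weakest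
sufficient joint row of the (β) plates side.  This file is the first of the LINK files (cf-p1 (ccc)(2)(ii)): it names the left-hand side of
that row as a statistic and proves the two invariances the window-form certificate needs — exactly as '…TailResidueMonoCapture'
(`localSummandA_transport`) and '…JammedReduction' (`localSummandA_congr_of_agree`) did for the (A) summand.  Nothing is claimed about any
census fact; no certificate is stated here (sequel '…SeamBiFrameRootRow'); F-C1 not moved.

* `localStatRootA v S₁ S₂ X z := Σ_{b : dist z b ≤ 1, endMultRootA b > 0} endMultRootA b / pooledDef b` — the LHS of `LocalEndRowRootA`
  (`localEndRowRootA_iff`); `localStatRootA_le_localSummandA` (the root statistic never exceeds the (A) summand);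
* TRANSPORT under `x ↦ S x + c` with the plate frames post-composed: `isRootEndPair_transport(_iff)`, `isEndPairRootA_transport_iff`,
  `endMultRootA_transport`, **`localStatRootA_transport`**;
* LOCALITY (radius `3` about the payer): `isRootEndPair_congr_of_agree`, `isEndPairRootA_congr_of_agree`, `endMultRootA_congr_of_agree`,
  **`localStatRootA_congr_of_agree`**.
WHAT THIS IS NOT: not a row, not a certificate, not the discharge; F-C1 not moved.
-/

noncomputable section

namespace Summit.Ventures.Crystal3D.Theorems

open Summit.Ventures.Crystal3D Finset
open scoped InnerProductSpace

/-! ### The root-class local statistic -/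

open scoped Classical in
/-- **THE ROOT-CLASS LOCAL STATISTIC** of the plate systems `(S₁, S₂)` at the payer `z`: the root-class end balls within `1` of `z`
load it by their root-class multiplicity per unit of pooled deficiency (the left-hand side of `LocalEndRowRootA`). -/
def localStatRootA (v : WordVersion) (S₁ S₂ : PlateSystem) (X : Finset (EuclideanSpace ℝ (Fin 3))) (z : EuclideanSpace ℝ (Fin 3)) : ℝ :=
  ∑ b ∈ X.filter (fun b => dist z b ≤ 1 ∧ 0 < endMultRootA X v S₁ S₂ b), (endMultRootA X v S₁ S₂ b : ℝ) / pooledDef X b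

open scoped Classical in
/-- `LocalEndRowRootA v sF S₁ S₂` IS «`localStatRootA ≤ sF` at every payer of every `1`-separated configuration». -/
theorem localEndRowRootA_iff {v : WordVersion} {sF : ℝ} {S₁ S₂ : PlateSystem} :
    LocalEndRowRootA v sF S₁ S₂ ↔
      ∀ X : Finset (EuclideanSpace ℝ (Fin 3)), (∀ p ∈ X, ∀ q ∈ X, p ≠ q → 1 ≤ dist p q) →
        ∀ z ∈ X, (X.filter fun q => dist z q = 1).card ≤ 11 → localStatRootA v S₁ S₂ X z ≤ sF :=
  Iff.rfl

open scoped Classical in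
/-- **The root statistic never exceeds the (A) summand** (the root row only removes pairs; cf. `localEndRowRootA_of_localEndRowA`). -/
theorem localStatRootA_le_localSummandA (v : WordVersion) (S₁ S₂ : PlateSystem) (X : Finset (EuclideanSpace ℝ (Fin 3)))
    (z : EuclideanSpace ℝ (Fin 3)) : localStatRootA v S₁ S₂ X z ≤ localSummandA v S₁ S₂ X z := by
  unfold localStatRootA localSummandA
  have hD : ∀ b, 0 ≤ pooledDef X b := by
    intro b
    refine sum_nonneg fun z' hz' => ?_
    have : ((X.filter fun q => dist z' q = 1).card : ℝ) ≤ 11 := by exact_mod_cast (mem_filter.1 hz').2.2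
    linarith
  calc ∑ b ∈ X.filter (fun b => dist z b ≤ 1 ∧ 0 < endMultRootA X v S₁ S₂ b), (endMultRootA X v S₁ S₂ b : ℝ) / pooledDef X b
      ≤ ∑ b ∈ X.filter (fun b => dist z b ≤ 1 ∧ 0 < endMultRootA X v S₁ S₂ b), (endMultA X v S₁ S₂ b : ℝ) / pooledDef X b :=
        sum_le_sum fun b _ => div_le_div_of_nonneg_right (by exact_mod_cast endMultRootA_le_endMultA X v S₁ S₂ b) (hD b)
    _ ≤ ∑ b ∈ X.filter (fun b => dist z b ≤ 1 ∧ 0 < endMultA X v S₁ S₂ b), (endMultA X v S₁ S₂ b : ℝ) / pooledDef X b := by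
        refine sum_le_sum_of_subset_of_nonneg (fun b hb => ?_) fun b _ _ => div_nonneg (Nat.cast_nonneg _) (hD b)
        obtain ⟨hbX, hd, hpos⟩ := mem_filter.1 hb
        exact mem_filter.2 ⟨hbX, hd, lt_of_lt_of_le hpos (endMultRootA_le_endMultA X v S₁ S₂ b)⟩

/-! ### Transport under a rigid motion `x ↦ S x + c` (plate frames post-composed with `S`) -/

section Transport

variable (X : Finset (EuclideanSpace ℝ (Fin 3))) (S : EuclideanSpace ℝ (Fin 3) ≃ₗᵢ[ℝ] EuclideanSpace ℝ (Fin 3))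
  (c : EuclideanSpace ℝ (Fin 3)) (v : WordVersion)

open scoped Classical in
/-- **Root-class end pairs transport** (forward). -/
theorem isRootEndPair_transport (L : EuclideanSpace ℝ (Fin 3) ≃ₗᵢ[ℝ] EuclideanSpace ℝ (Fin 3)) (R : Finset (EuclideanSpace ℝ (Fin 3)))
    {b q : EuclideanSpace ℝ (Fin 3)} (h : IsRootEndPair X v ⟨L, R⟩ b q) :
    IsRootEndPair (X.image fun x => S x + c) v ⟨L.trans S, R⟩ (S b + c) (S q + c) := by
  obtain ⟨hq, hb, hpay, r, hr, hbq, hpred, hmove⟩ := h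
  refine ⟨mem_image_of_mem _ hq, mem_image_of_mem _ hb, hasTwoPayers_transport X S c hpay, r, hr, ?_, ?_, ?_⟩
  · show S b + c = S q + c + S (L r)
    rw [hbq, map_add]; abel
  · have e : S q + c - S (L r) = S (q - L r) + c := by rw [map_sub]; abel
    show S q + c - S (L r) ∈ X.image fun x => S x + c
    rw [e]; exact mem_image_of_mem _ hpred
  · show IsEndMove (X.image fun x => S x + c) v (L.trans S) (S (L r)) (S q + c) (S b + c)
    exact isEndMove_transport S c hmove

open scoped Classical in
/-- **Root-class end pairs transport both ways.** -/
theorem isRootEndPair_transport_iff (L : EuclideanSpace ℝ (Fin 3) ≃ₗᵢ[ℝ] EuclideanSpace ℝ (Fin 3)) (R : Finset (EuclideanSpace ℝ (Fin 3)))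
    {b q : EuclideanSpace ℝ (Fin 3)} :
    IsRootEndPair (X.image fun x => S x + c) v ⟨L.trans S, R⟩ (S b + c) (S q + c) ↔ IsRootEndPair X v ⟨L, R⟩ b q := by
  constructor
  · intro h
    have h' := isRootEndPair_transport (X.image fun x => S x + c) S.symm (-S.symm c) v (L.trans S) R h
    rw [TailResidue.image_rigid_symm, TailResidue.trans_trans_symm] at h'
    have e1 : S.symm (S b + c) + -S.symm c = b := by simp [map_add]
    have e2 : S.symm (S q + c) + -S.symm c = q := by simp [map_add]
    rwa [e1, e2] at h'
  · exact isRootEndPair_transport X S c v L R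

open scoped Classical in
/-- **Root-class end pairs of the two-plate pair transport both ways.** -/
theorem isEndPairRootA_transport_iff (L₁ L₂ : EuclideanSpace ℝ (Fin 3) ≃ₗᵢ[ℝ] EuclideanSpace ℝ (Fin 3))
    (R₁ R₂ : Finset (EuclideanSpace ℝ (Fin 3))) {b q : EuclideanSpace ℝ (Fin 3)} :
    IsEndPairRootA (X.image fun x => S x + c) v ⟨L₁.trans S, R₁⟩ ⟨L₂.trans S, R₂⟩ (S b + c) (S q + c) ↔
      IsEndPairRootA X v ⟨L₁, R₁⟩ ⟨L₂, R₂⟩ b q :=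
  or_congr (isRootEndPair_transport_iff X S c v L₁ R₁) (isRootEndPair_transport_iff X S c v L₂ R₂)

open scoped Classical in
/-- **Root-class multiplicities transport.** -/
theorem endMultRootA_transport (L₁ L₂ : EuclideanSpace ℝ (Fin 3) ≃ₗᵢ[ℝ] EuclideanSpace ℝ (Fin 3)) (R₁ R₂ : Finset (EuclideanSpace ℝ (Fin 3)))
    (b : EuclideanSpace ℝ (Fin 3)) :
    endMultRootA (X.image fun x => S x + c) v ⟨L₁.trans S, R₁⟩ ⟨L₂.trans S, R₂⟩ (S b + c) = endMultRootA X v ⟨L₁, R₁⟩ ⟨L₂, R₂⟩ b := by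
  unfold endMultRootA
  have hset : ((X.image fun x => S x + c).filter fun q =>
        IsEndPairRootA (X.image fun x => S x + c) v ⟨L₁.trans S, R₁⟩ ⟨L₂.trans S, R₂⟩ (S b + c) q) =
      (X.filter fun q => IsEndPairRootA X v ⟨L₁, R₁⟩ ⟨L₂, R₂⟩ b q).image fun x => S x + c := by
    ext y
    simp only [mem_filter, mem_image]
    constructor
    · rintro ⟨⟨x, hx, rfl⟩, hp⟩
      exact ⟨x, ⟨hx, (isEndPairRootA_transport_iff X S c v L₁ L₂ R₁ R₂).1 hp⟩, rfl⟩
    · rintro ⟨x, ⟨hx, hp⟩, rfl⟩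
      exact ⟨⟨x, hx, rfl⟩, (isEndPairRootA_transport_iff X S c v L₁ L₂ R₁ R₂).2 hp⟩
  rw [hset, card_image_of_injective _ (rigid_injective S c)]

open scoped Classical in
/-- **THE ROOT STATISTIC TRANSPORTS** under a rigid motion, the plate systems' base frames transported. -/
theorem localStatRootA_transport (L₁ L₂ : EuclideanSpace ℝ (Fin 3) ≃ₗᵢ[ℝ] EuclideanSpace ℝ (Fin 3)) (R₁ R₂ : Finset (EuclideanSpace ℝ (Fin 3)))
    (z : EuclideanSpace ℝ (Fin 3)) :
    localStatRootA v ⟨L₁.trans S, R₁⟩ ⟨L₂.trans S, R₂⟩ (X.image fun x => S x + c) (S z + c) = localStatRootA v ⟨L₁, R₁⟩ ⟨L₂, R₂⟩ X z := by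
  unfold localStatRootA
  have hset : ((X.image fun x => S x + c).filter fun b => dist (S z + c) b ≤ 1 ∧
        0 < endMultRootA (X.image fun x => S x + c) v ⟨L₁.trans S, R₁⟩ ⟨L₂.trans S, R₂⟩ b) =
      (X.filter fun b => dist z b ≤ 1 ∧ 0 < endMultRootA X v ⟨L₁, R₁⟩ ⟨L₂, R₂⟩ b).image fun x => S x + c := by
    ext y
    simp only [mem_filter, mem_image]
    constructor
    · rintro ⟨⟨x, hx, rfl⟩, hd, hpos⟩
      rw [dist_rigid] at hd
      rw [endMultRootA_transport] at hpos
      exact ⟨x, ⟨hx, hd, hpos⟩, rfl⟩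
    · rintro ⟨x, ⟨hx, hd, hpos⟩, rfl⟩
      exact ⟨⟨x, hx, rfl⟩, by rw [dist_rigid]; exact hd, by rw [endMultRootA_transport]; exact hpos⟩
  rw [hset, sum_image fun x _ y _ h => rigid_injective S c h]
  refine sum_congr rfl fun b _ => ?_
  rw [endMultRootA_transport, pooledDef_transport]

end Transport

/-! ### Locality: the root statistic at `z` depends only on the balls within `dist c z + 3` of `c` -/

section Agree

variable {X Y : Finset (EuclideanSpace ℝ (Fin 3))} {c : EuclideanSpace ℝ (Fin 3)} {ρ : ℝ}
  (h : ∀ x, dist c x ≤ ρ → (x ∈ X ↔ x ∈ Y)) {v : WordVersion}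

include h in
/-- Root-class end pairs of a ball `b` with `dist c b + 2 ≤ ρ` depend only on the balls within `ρ` of `c` (one direction). -/
theorem isRootEndPair_of_agree {S : PlateSystem} (hS : S.RT ⊆ fccSlots) {b q : EuclideanSpace ℝ (Fin 3)} (hb : dist c b + 2 ≤ ρ)
    (hp : IsRootEndPair X v S b q) : IsRootEndPair Y v S b q := by
  obtain ⟨hq, hbX, hpay, r, hr, hbq, hpred, hmove⟩ := hp
  have hd1 : ‖S.G₀ r‖ = 1 := by rw [LinearIsometryEquiv.norm_map, norm_eq_one_of_mem_fccSlots (hS hr)]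
  have hbq1 : dist b q = 1 := by rw [hbq, dist_comm, dist_eq_norm, show q - (q + S.G₀ r) = -S.G₀ r by abel, norm_neg, hd1]
  have hcq : dist c q ≤ dist c b + 1 := by linarith [dist_triangle c b q]
  have hqd' : dist q (q - S.G₀ r) = 1 := by rw [dist_eq_norm, sub_sub_cancel, hd1]
  have hcqd : dist c (q - S.G₀ r) ≤ dist c b + 2 := by linarith [dist_triangle c q (q - S.G₀ r)]
  exact ⟨(h q (by linarith)).1 hq, (h b (by linarith)).1 hbX, (hasTwoPayers_congr_of_agree h hb).1 hpay, r, hr, hbq,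
    (h _ (by linarith)).1 hpred, (isEndMove_congr_of_agree h v S.G₀ hd1 (by linarith) (by linarith)).1 hmove⟩

include h in
/-- Root-class end pairs of a ball `b` with `dist c b + 2 ≤ ρ` depend only on the balls within `ρ` of `c`. -/
theorem isRootEndPair_congr_of_agree {S : PlateSystem} (hS : S.RT ⊆ fccSlots) {b q : EuclideanSpace ℝ (Fin 3)} (hb : dist c b + 2 ≤ ρ) :
    IsRootEndPair X v S b q ↔ IsRootEndPair Y v S b q :=
  ⟨isRootEndPair_of_agree h hS hb, isRootEndPair_of_agree (fun x hx => (h x hx).symm) hS hb⟩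

variable {S₁ S₂ : PlateSystem} (h₁ : S₁.RT ⊆ fccSlots) (h₂ : S₂.RT ⊆ fccSlots)

include h h₁ h₂ in
/-- Root-class end pairs of the two-plate pair agree. -/
theorem isEndPairRootA_congr_of_agree {b q : EuclideanSpace ℝ (Fin 3)} (hb : dist c b + 2 ≤ ρ) :
    IsEndPairRootA X v S₁ S₂ b q ↔ IsEndPairRootA Y v S₁ S₂ b q :=
  or_congr (isRootEndPair_congr_of_agree h h₁ hb) (isRootEndPair_congr_of_agree h h₂ hb)

include h h₁ h₂ in
open scoped Classical in
/-- Root-class multiplicities agree. -/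
theorem endMultRootA_congr_of_agree {b : EuclideanSpace ℝ (Fin 3)} (hb : dist c b + 2 ≤ ρ) :
    endMultRootA X v S₁ S₂ b = endMultRootA Y v S₁ S₂ b := by
  unfold endMultRootA
  congr 1
  ext q
  simp only [mem_filter]
  constructor
  · rintro ⟨-, hp⟩
    have hp' := (isEndPairRootA_congr_of_agree h h₁ h₂ hb).1 hp
    exact ⟨(isEndPairA_of_isEndPairRootA hp').1, hp'⟩
  · rintro ⟨-, hp⟩
    have hp' := (isEndPairRootA_congr_of_agree h h₁ h₂ hb).2 hp
    exact ⟨(isEndPairA_of_isEndPairRootA hp').1, hp'⟩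

include h h₁ h₂ in
open scoped Classical in
/-- **The root statistic at `z` depends only on the balls within `dist c z + 3` of `c`.** -/
theorem localStatRootA_congr_of_agree {z : EuclideanSpace ℝ (Fin 3)} (hz : dist c z + 3 ≤ ρ) :
    localStatRootA v S₁ S₂ X z = localStatRootA v S₁ S₂ Y z := by
  unfold localStatRootA
  have hset : X.filter (fun b => dist z b ≤ 1 ∧ 0 < endMultRootA X v S₁ S₂ b) =
      Y.filter (fun b => dist z b ≤ 1 ∧ 0 < endMultRootA Y v S₁ S₂ b) := by
    ext b
    simp only [mem_filter]
    constructor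
    · rintro ⟨hbX, hzb, hpos⟩
      have hcb : dist c b + 2 ≤ ρ := by linarith [dist_triangle c z b]
      exact ⟨(h b (by linarith)).1 hbX, hzb, by rwa [← endMultRootA_congr_of_agree h h₁ h₂ hcb]⟩
    · rintro ⟨hbY, hzb, hpos⟩
      have hcb : dist c b + 2 ≤ ρ := by linarith [dist_triangle c z b]
      exact ⟨(h b (by linarith)).2 hbY, hzb, by rwa [endMultRootA_congr_of_agree h h₁ h₂ hcb]⟩
  rw [hset]
  refine sum_congr rfl fun b hb => ?_
  obtain ⟨-, hzb, -⟩ := mem_filter.1 hb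
  have hcb : dist c b + 2 ≤ ρ := by linarith [dist_triangle c z b]
  rw [endMultRootA_congr_of_agree h h₁ h₂ hcb, pooledDef_congr_of_agree h hcb]

end Agree

end Summit.Ventures.Crystal3D.Theorems

end
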